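import Summits.QuantumFields.YangMills.Theorems.SwapVirialDeficitZeroModeGroupThreePointwise
import Summits.QuantumFields.YangMills.Theorems.SwapVirialDeficitZeroModeGroupThreeGaussian
import HarnessLib

/-!
# Exact zero-mode rung on the GROUP, three letters — V-b: the dominator is integrable (the no-log mechanism on `SU(2)³`)
# (rung Z4 in Laplace form; free-hands support of ⟨stmt-QuantumFields-24197⟩, LINE «sharp-sigma»)

Part IV produced the β-free dominator `G_r(x,y) = 𝟙{x₀²+x_I²<1}𝟙{y₀²+y_I²<1}·exp(−4[r²(x_J²+x_K²+y_J²+y_K²) + (x_Ky_I−x_Iy_K)² + (x_Iy_J−x_Jy_I)²])`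
of the rescaled integrand at an axis hub with `r = ‖Im a‖`.  Here (★★ `lintegral_dominator_le`)
`∫∫ G_r dx dy ≤ 4·(π²/48)·(r²)^{−4/3}·I(1/3)²`, `I(c) = ∫_{(−1,1)} (u²)^{−c} du < ∞`:
in the pair coordinates of part V-a the two transverse pairs `(x_J,y_J)`, `(x_K,y_K)` are EXACT coupled Gaussians
`∫ e^{−4[r²|w|²+(x_Iw₂−w₁y_I)²]} dw = π/(4r√(r²+x_I²+y_I²))` (§2), whose product `π²/(16r²(r²+x_I²+y_I²))` is bounded by weighted AM–GM
by the separable singular weight `(π²/48)(r²)^{−4/3}(x_I²)^{−1/3}(y_I²)^{−1/3}` (§3) — integrable on the longitudinal box (§4).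
(The hub weight `(‖Im a‖²)^{−4/3}` is integrated in part V-c by the same AM–GM: `≤ 3^{−4/3}(a_I²)^{−4/9}(a_J²)^{−4/9}(a_K²)^{−4/9}`, ★ `hub_bound`.)
This is the finiteness input `∫ bound < ∞` of the inner dominated-convergence step of part V-c.
HONEST LABEL: finite-dimensional real analysis (plan-level zero-mode rung, Laplace/Abelian side); NOT the fixed-`L` sharp law, NOT ⟨24197⟩;
the Yang–Mills mass gap is NOT proved; no summit is proved by a line.  Width seat ym-line-sfw-p2-w2 g55 (cell ym-idea-1, free hands;
own crux ⟨22884⟩ blocked-on ⟨19935⟩), `--supports stmt-QuantumFields-24197`.  Standard axioms, 0 `sorry`; the three local instances of the ToronLog files.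
References: [cite: GonzalezarroyoAltes1988]; [cite: Vanbaal2001]; [folklore].
-/

set_option autoImplicit false

noncomputable section

open MeasureTheory Quaternion Set Filter Topology
open scoped Quaternion ENNReal
open Literature.MathematicalPhysics.QuantumLattice
open Summit.QuantumFields.YangMills.Theorems.SwapTwistDeficit.ToronLog

attribute [local instance] Literature.Analysis.FluidPDE.Tao2016.quatMeasurableSpace
  Literature.Analysis.FluidPDE.Tao2016.quatBorelSpace
  Literature.MathematicalPhysics.QuantumLattice.secondCountableTopology_su2

namespace Summit.QuantumFields.YangMills.Theorems.SwapVirialDeficit.ZeroModeGroup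

/-! ## §1 Product-measure helpers and the singular weight -/

/-- The coordinate `re` is measurable on `ℍ` (for `fun_prop`). [folklore] -/
@[fun_prop] theorem measurable_quat_re : Measurable fun q : ℍ => q.re := Quaternion.continuous_re.measurable

/-- The coordinate `imI` is measurable on `ℍ` (for `fun_prop`). [folklore] -/
@[fun_prop] theorem measurable_quat_imI : Measurable fun q : ℍ => q.imI := Quaternion.continuous_imI.measurable

/-- The coordinate `imJ` is measurable on `ℍ` (for `fun_prop`). [folklore] -/
@[fun_prop] theorem measurable_quat_imJ : Measurable fun q : ℍ => q.imJ := Quaternion.continuous_imJ.measurable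

/-- The coordinate `imK` is measurable on `ℍ` (for `fun_prop`). [folklore] -/
@[fun_prop] theorem measurable_quat_imK : Measurable fun q : ℍ => q.imK := Quaternion.continuous_imK.measurable

/-- Tonelli on a product of measure spaces (volume form). [folklore] -/
theorem lintegral_volume_prod {α β : Type*} [MeasureSpace α] [MeasureSpace β] [SFinite (volume : Measure α)]
    [SFinite (volume : Measure β)] (f : α × β → ℝ≥0∞) (hf : Measurable f) :
    ∫⁻ z, f z = ∫⁻ x, ∫⁻ y, f (x, y) := by
  rw [Measure.volume_eq_prod]; exact lintegral_prod f hf.aemeasurable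

/-- A product integrand integrates to the product of the integrals (volume form). [folklore] -/
theorem lintegral_volume_prod_mul {α β : Type*} [MeasureSpace α] [MeasureSpace β] [SFinite (volume : Measure α)]
    [SFinite (volume : Measure β)] {f : α → ℝ≥0∞} {g : β → ℝ≥0∞} (hf : Measurable f) (hg : Measurable g) :
    ∫⁻ z : α × β, f z.1 * g z.2 = (∫⁻ x, f x) * ∫⁻ y, g y := by
  rw [Measure.volume_eq_prod]; exact lintegral_prod_mul hf.aemeasurable hg.aemeasurable

/-- The singular weight `(u²)^{−c}`, with value `⊤` at `u = 0` so that the AM–GM bounds below hold EVERYWHERE. [folklore] -/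
def singPow (c : ℝ) (u : ℝ) : ℝ≥0∞ := if u = 0 then ⊤ else ENNReal.ofReal ((u ^ 2) ^ (-c))

/-- `singPow` off the origin. [folklore] -/
theorem singPow_of_ne {c u : ℝ} (hu : u ≠ 0) : singPow c u = ENNReal.ofReal ((u ^ 2) ^ (-c)) := by rw [singPow, if_neg hu]

/-- `singPow` at the origin. [folklore] -/
theorem singPow_zero (c : ℝ) : singPow c 0 = ⊤ := by rw [singPow, if_pos rfl]

/-- `singPow` never vanishes. [folklore] -/
theorem singPow_ne_zero (c u : ℝ) : singPow c u ≠ 0 := by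
  by_cases hu : u = 0
  · rw [hu, singPow_zero]; exact ENNReal.top_ne_zero
  · rw [singPow_of_ne hu]; exact (ENNReal.ofReal_pos.2 (Real.rpow_pos_of_pos (by positivity) _)).ne'

/-- `singPow` is measurable. [folklore] -/
theorem measurable_singPow (c : ℝ) : Measurable (singPow c) := by
  unfold singPow
  refine Measurable.ite ?_ measurable_const (ENNReal.measurable_ofReal.comp ((measurable_id.pow_const 2).pow_const _))
  simp only [setOf_eq_eq_singleton]; exact measurableSet_singleton 0

/-- The longitudinal window `{u² < 1}` is measurable. [folklore] -/
theorem measurableSet_sqLine : MeasurableSet {u : ℝ | u ^ 2 < 1} := measurableSet_lt (measurable_id.pow_const 2) measurable_const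

/-- The boxed singular weight is measurable. [folklore] -/
theorem measurable_boxSing (c : ℝ) : Measurable fun u => {u : ℝ | u ^ 2 < 1}.indicator (singPow c) u :=
  (measurable_singPow c).indicator measurableSet_sqLine

/-- The one-dimensional singular integral `I(c) = ∫_{(−1,1)} (u²)^{−c} du` (as `ℝ≥0∞`). [folklore] -/
def Ising (c : ℝ) : ℝ≥0∞ := ∫⁻ u, {u : ℝ | u ^ 2 < 1}.indicator (singPow c) u

/-- `I(c) < ∞` for `0 < c < 1/2`. [folklore] -/
theorem Ising_lt_top {c : ℝ} (hc0 : 0 < c) (hc : 2 * c < 1) : Ising c < ∞ := by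
  have hae : (fun u => {u : ℝ | u ^ 2 < 1}.indicator (singPow c) u) =ᵐ[volume]
      fun u => {u : ℝ | u ^ 2 < 1}.indicator (fun u => ENNReal.ofReal ((u ^ 2) ^ (-c))) u := by
    have h0 : ∀ᵐ u ∂(volume : Measure ℝ), u ≠ 0 := by simp [ae_iff]
    filter_upwards [h0] with u hu
    by_cases hm : u ∈ {u : ℝ | u ^ 2 < 1}
    · rw [indicator_of_mem hm, indicator_of_mem hm, singPow_of_ne hu]
    · rw [indicator_of_notMem hm, indicator_of_notMem hm]
  rw [Ising, lintegral_congr_ae hae]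
  exact lintegral_sqBox_rpow_lt_top hc0 hc

/-! ## §2 The transverse pair Gaussian -/

/-- The transverse pair Gaussian in the pair frame, `q = (x_I, y_I)`, `w = (x_c, y_c)`:
`g_r(q,w) = exp(−4[r²|w|² + (x_Iw₂ − w₁y_I)²])`, written as the quadratic form `αw₁² + 2γw₁w₂ + δw₂²` with
`α = 4(r²+y_I²)`, `γ = −4x_Iy_I`, `δ = 4(r²+x_I²)` (`αδ − γ² = 16r²(r²+x_I²+y_I²)`). [folklore] -/
def gq (r : ℝ) (q w : ℝ × ℝ) : ℝ≥0∞ :=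
  ENNReal.ofReal (Real.exp (-(4 * (r ^ 2 + q.2 ^ 2) * w.1 ^ 2 + 2 * (-(4 * q.1 * q.2)) * w.1 * w.2 + 4 * (r ^ 2 + q.1 ^ 2) * w.2 ^ 2)))

/-- Unfolding `gq` (made irreducible below). [folklore] -/
theorem gq_def (r : ℝ) (q w : ℝ × ℝ) : gq r q w =
    ENNReal.ofReal (Real.exp (-(4 * (r ^ 2 + q.2 ^ 2) * w.1 ^ 2 + 2 * (-(4 * q.1 * q.2)) * w.1 * w.2 + 4 * (r ^ 2 + q.1 ^ 2) * w.2 ^ 2))) := rfl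

/-- `g_r` is jointly measurable. [folklore] -/
theorem measurable_gq (r : ℝ) : Measurable fun v : (ℝ × ℝ) × (ℝ × ℝ) => gq r v.1 v.2 := by
  unfold gq; exact ENNReal.measurable_ofReal.comp (Real.measurable_exp.comp (by fun_prop))

/-- `g_r(q, ·)` is measurable. [folklore] -/
theorem measurable_gq_right (r : ℝ) (q : ℝ × ℝ) : Measurable (gq r q) := by
  have : Measurable fun w : ℝ × ℝ => gq r q w := by
    unfold gq; exact ENNReal.measurable_ofReal.comp (Real.measurable_exp.comp (by fun_prop))
  exact this

/-- ★ The exact coupled Gaussian: `∫ g_r(q,w) dw = π/√(16r²(r²+x_I²+y_I²))` (`r > 0`). [folklore] -/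
theorem lintegral_gq {r : ℝ} (hr : 0 < r) (q : ℝ × ℝ) :
    ∫⁻ w, gq r q w = ENNReal.ofReal (Real.pi / Real.sqrt (16 * r ^ 2 * (r ^ 2 + q.1 ^ 2 + q.2 ^ 2))) := by
  have hD : 4 * (r ^ 2 + q.2 ^ 2) * (4 * (r ^ 2 + q.1 ^ 2)) - (-(4 * q.1 * q.2)) ^ 2 = 16 * r ^ 2 * (r ^ 2 + q.1 ^ 2 + q.2 ^ 2) := by
    ring
  have hpos : 0 < 16 * r ^ 2 * (r ^ 2 + q.1 ^ 2 + q.2 ^ 2) := by positivity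
  unfold gq
  rw [lintegral_exp_neg_quadForm_two (by positivity) (by rw [hD]; exact hpos), hD]

/-- The two transverse pairs together: `(∫ g_r(q,·))² = π²/(16r²(r²+x_I²+y_I²))`. [folklore] -/
theorem lintegral_gq_mul_self {r : ℝ} (hr : 0 < r) (q : ℝ × ℝ) :
    (∫⁻ w, gq r q w) * (∫⁻ w, gq r q w) = ENNReal.ofReal (Real.pi ^ 2 / (16 * r ^ 2 * (r ^ 2 + q.1 ^ 2 + q.2 ^ 2))) := by
  have hpos : 0 < 16 * r ^ 2 * (r ^ 2 + q.1 ^ 2 + q.2 ^ 2) := by positivity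
  rw [lintegral_gq hr, ← ENNReal.ofReal_mul (by positivity)]
  congr 1
  rw [div_mul_div_comm, Real.mul_self_sqrt hpos.le]; ring

attribute [irreducible] gq

/-! ## §3 Weighted AM–GM: separable singular bounds -/

/-- `π²/(16r²(r²+x_I²+y_I²)) ≤ (π²/48)(r²)^{−4/3}(x_I²)^{−1/3}(y_I²)^{−1/3}` (all three nonzero). [folklore] -/
theorem dom_q_bound {r q₁ q₂ : ℝ} (hr : r ≠ 0) (h1 : q₁ ≠ 0) (h2 : q₂ ≠ 0) :
    Real.pi ^ 2 / (16 * r ^ 2 * (r ^ 2 + q₁ ^ 2 + q₂ ^ 2)) ≤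
      Real.pi ^ 2 / 48 * (r ^ 2) ^ (-(4/3 : ℝ)) * ((q₁ ^ 2) ^ (-(1/3 : ℝ)) * (q₂ ^ 2) ^ (-(1/3 : ℝ))) := by
  have hr2 : 0 < r ^ 2 := by positivity
  have hq1 : 0 < q₁ ^ 2 := by positivity
  have hq2 : 0 < q₂ ^ 2 := by positivity
  have hA := rpow_neg_sum_three_le hr2 hq1 hq2 zero_le_one
  have e1 : Real.pi ^ 2 / (16 * r ^ 2 * (r ^ 2 + q₁ ^ 2 + q₂ ^ 2)) =
      Real.pi ^ 2 / 16 * (r ^ 2) ^ (-(1:ℝ)) * (r ^ 2 + q₁ ^ 2 + q₂ ^ 2) ^ (-(1:ℝ)) := by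
    rw [Real.rpow_neg_one, Real.rpow_neg_one]; field_simp
  have e2 : (r ^ 2) ^ (-(4/3 : ℝ)) = (r ^ 2) ^ (-(1:ℝ)) * (r ^ 2) ^ (-(1/3 : ℝ)) := by
    rw [← Real.rpow_add hr2]; norm_num
  rw [e1, e2]
  have h16 : 0 ≤ Real.pi ^ 2 / 16 * (r ^ 2) ^ (-(1:ℝ)) := by positivity
  calc Real.pi ^ 2 / 16 * (r ^ 2) ^ (-(1:ℝ)) * (r ^ 2 + q₁ ^ 2 + q₂ ^ 2) ^ (-(1:ℝ))
      ≤ Real.pi ^ 2 / 16 * (r ^ 2) ^ (-(1:ℝ)) *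
          ((3:ℝ) ^ (-(1:ℝ)) * ((r ^ 2) ^ (-(1/3 : ℝ)) * (q₁ ^ 2) ^ (-(1/3 : ℝ)) * (q₂ ^ 2) ^ (-(1/3 : ℝ)))) :=
        mul_le_mul_of_nonneg_left hA h16
    _ = _ := by rw [Real.rpow_neg_one]; ring

/-- `(a_I²+a_J²+a_K²)^{−4/3} ≤ 3^{−4/3}(a_I²)^{−4/9}(a_J²)^{−4/9}(a_K²)^{−4/9}` (all three nonzero). [folklore] -/
theorem hub_bound {t₁ t₂ t₃ : ℝ} (h₁ : t₁ ≠ 0) (h₂ : t₂ ≠ 0) (h₃ : t₃ ≠ 0) :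
    (t₁ ^ 2 + t₂ ^ 2 + t₃ ^ 2) ^ (-(4/3 : ℝ)) ≤
      (3:ℝ) ^ (-(4/3 : ℝ)) * ((t₁ ^ 2) ^ (-(4/9 : ℝ)) * (t₂ ^ 2) ^ (-(4/9 : ℝ)) * (t₃ ^ 2) ^ (-(4/9 : ℝ))) := by
  have h := rpow_neg_sum_three_le (p := 4/3) (by positivity : 0 < t₁ ^ 2) (by positivity : 0 < t₂ ^ 2)
    (by positivity : 0 < t₃ ^ 2) (by norm_num)
  have e : -((4/3 : ℝ) / 3) = -(4/9 : ℝ) := by norm_num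
  rw [e] at h
  exact h

/-- ENNReal form of `dom_q_bound` with the `⊤`-valued singular weights (valid for ALL `x_I, y_I`). [folklore] -/
theorem gaussSq_le_sing {r : ℝ} (hr : 0 < r) (q₁ q₂ : ℝ) :
    ENNReal.ofReal (Real.pi ^ 2 / (16 * r ^ 2 * (r ^ 2 + q₁ ^ 2 + q₂ ^ 2))) ≤
      ENNReal.ofReal (Real.pi ^ 2 / 48 * (r ^ 2) ^ (-(4/3 : ℝ))) * (singPow (1/3) q₁ * singPow (1/3) q₂) := by
  have hK : 0 < Real.pi ^ 2 / 48 * (r ^ 2) ^ (-(4/3 : ℝ)) := by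
    have := Real.rpow_pos_of_pos (pow_pos hr 2) (-(4/3 : ℝ)); positivity
  have hKne : ENNReal.ofReal (Real.pi ^ 2 / 48 * (r ^ 2) ^ (-(4/3 : ℝ))) ≠ 0 := (ENNReal.ofReal_pos.2 hK).ne'
  by_cases h1 : q₁ = 0
  · rw [h1, singPow_zero, ENNReal.top_mul (singPow_ne_zero _ _), ENNReal.mul_top hKne]; exact le_top
  by_cases h2 : q₂ = 0
  · rw [h2, singPow_zero, ENNReal.mul_top (singPow_ne_zero _ _), ENNReal.mul_top hKne]; exact le_top
  rw [singPow_of_ne h1, singPow_of_ne h2, ← ENNReal.ofReal_mul (Real.rpow_nonneg (sq_nonneg _) _), ← ENNReal.ofReal_mul hK.le]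
  refine ENNReal.ofReal_le_ofReal ?_
  have := dom_q_bound hr.ne' h1 h2
  simpa only [mul_assoc] using this

/-! ## §4 The dominator in the pair frame and its integral -/

/-- The longitudinal box `{x₀² < 1} × {y₀² < 1}` (resp. `{x_I² < 1} × {y_I² < 1}`). [folklore] -/
def sqBox : Set (ℝ × ℝ) := {u : ℝ | u ^ 2 < 1} ×ˢ {u : ℝ | u ^ 2 < 1}

/-- `sqBox` is measurable. [folklore] -/
theorem measurableSet_sqBox : MeasurableSet sqBox := measurableSet_sqLine.prod measurableSet_sqLine

/-- `vol(sqBox) = 4`. [folklore] -/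
theorem volume_sqBox : volume sqBox = 4 := by
  rw [sqBox, Measure.volume_eq_prod, Measure.prod_prod, volume_sqBox_one]; norm_num

/-- The separable majorant of the dominator in the pair frame `w = ((x₀,y₀),((x_I,y_I),((x_J,y_J),(x_K,y_K))))`:
`𝟙_{box}(x₀,y₀)·𝟙_{box}(x_I,y_I)·g_r(q,w_J)·g_r(q,w_K)`. [folklore] -/
def Fdom (r : ℝ) (w : (ℝ × ℝ) × ((ℝ × ℝ) × ((ℝ × ℝ) × (ℝ × ℝ)))) : ℝ≥0∞ :=
  sqBox.indicator (fun _ => (1 : ℝ≥0∞)) w.1 * (sqBox.indicator (fun _ => (1 : ℝ≥0∞)) w.2.1 * (gq r w.2.1 w.2.2.1 * gq r w.2.1 w.2.2.2))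

/-- The inner factor of `Fdom` is measurable. [folklore] -/
theorem measurable_Fdom_inner (r : ℝ) :
    Measurable fun u : (ℝ × ℝ) × ((ℝ × ℝ) × (ℝ × ℝ)) => sqBox.indicator (fun _ => (1 : ℝ≥0∞)) u.1 * (gq r u.1 u.2.1 * gq r u.1 u.2.2) := by
  have hi : Measurable fun p : ℝ × ℝ => sqBox.indicator (fun _ => (1 : ℝ≥0∞)) p := measurable_const.indicator measurableSet_sqBox
  have h1 : Measurable fun u : (ℝ × ℝ) × ((ℝ × ℝ) × (ℝ × ℝ)) => gq r u.1 u.2.1 :=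
    (measurable_gq r).comp (measurable_fst.prodMk (measurable_fst.comp measurable_snd))
  have h2 : Measurable fun u : (ℝ × ℝ) × ((ℝ × ℝ) × (ℝ × ℝ)) => gq r u.1 u.2.2 :=
    (measurable_gq r).comp (measurable_fst.prodMk (measurable_snd.comp measurable_snd))
  exact (hi.comp measurable_fst).mul (h1.mul h2)

/-- `Fdom` is measurable. [folklore] -/
theorem measurable_Fdom (r : ℝ) : Measurable (Fdom r) := by
  have hi : Measurable fun p : ℝ × ℝ => sqBox.indicator (fun _ => (1 : ℝ≥0∞)) p := measurable_const.indicator measurableSet_sqBox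
  exact (hi.comp measurable_fst).mul ((measurable_Fdom_inner r).comp measurable_snd)

/-- ★★ `∫ Fdom_r ≤ 4·(π²/48)(r²)^{−4/3}·I(1/3)²`: Tonelli in the pair frame, the exact coupled Gaussians, AM–GM. [folklore] -/
theorem lintegral_Fdom_le {r : ℝ} (hr : 0 < r) :
    ∫⁻ w, Fdom r w ≤ 4 * (ENNReal.ofReal (Real.pi ^ 2 / 48 * (r ^ 2) ^ (-(4/3 : ℝ))) * (Ising (1/3) * Ising (1/3))) := by
  have hpair : ∀ q : ℝ × ℝ, ∫⁻ v : (ℝ × ℝ) × (ℝ × ℝ), gq r q v.1 * gq r q v.2 =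
      ENNReal.ofReal (Real.pi ^ 2 / (16 * r ^ 2 * (r ^ 2 + q.1 ^ 2 + q.2 ^ 2))) := by
    intro q
    rw [lintegral_volume_prod_mul (measurable_gq_right r q) (measurable_gq_right r q), lintegral_gq_mul_self hr]
  have hmid : ∫⁻ u : (ℝ × ℝ) × ((ℝ × ℝ) × (ℝ × ℝ)), sqBox.indicator (fun _ => (1 : ℝ≥0∞)) u.1 * (gq r u.1 u.2.1 * gq r u.1 u.2.2) ≤
      ENNReal.ofReal (Real.pi ^ 2 / 48 * (r ^ 2) ^ (-(4/3 : ℝ))) * (Ising (1/3) * Ising (1/3)) := by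
    rw [lintegral_volume_prod _ (measurable_Fdom_inner r)]
    have hin : ∀ q : ℝ × ℝ, ∫⁻ v : (ℝ × ℝ) × (ℝ × ℝ), sqBox.indicator (fun _ => (1 : ℝ≥0∞)) q * (gq r q v.1 * gq r q v.2) =
        sqBox.indicator (fun _ => (1 : ℝ≥0∞)) q * ENNReal.ofReal (Real.pi ^ 2 / (16 * r ^ 2 * (r ^ 2 + q.1 ^ 2 + q.2 ^ 2))) := by
      intro q
      have hm : Measurable fun v : (ℝ × ℝ) × (ℝ × ℝ) => gq r q v.1 * gq r q v.2 :=
        ((measurable_gq_right r q).comp measurable_fst).mul ((measurable_gq_right r q).comp measurable_snd)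
      rw [lintegral_const_mul _ hm, hpair q]
    simp_rw [hin]
    calc ∫⁻ q : ℝ × ℝ, sqBox.indicator (fun _ => (1 : ℝ≥0∞)) q * ENNReal.ofReal (Real.pi ^ 2 / (16 * r ^ 2 * (r ^ 2 + q.1 ^ 2 + q.2 ^ 2)))
        ≤ ∫⁻ q : ℝ × ℝ, ENNReal.ofReal (Real.pi ^ 2 / 48 * (r ^ 2) ^ (-(4/3 : ℝ))) *
            ({u : ℝ | u ^ 2 < 1}.indicator (singPow (1/3)) q.1 * {u : ℝ | u ^ 2 < 1}.indicator (singPow (1/3)) q.2) := by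
          refine lintegral_mono fun q => ?_
          by_cases hq : q ∈ sqBox
          · rw [indicator_of_mem hq, one_mul, indicator_of_mem hq.1, indicator_of_mem hq.2]
            exact gaussSq_le_sing hr q.1 q.2
          · rw [indicator_of_notMem hq, zero_mul]; exact bot_le
      _ = ENNReal.ofReal (Real.pi ^ 2 / 48 * (r ^ 2) ^ (-(4/3 : ℝ))) * (Ising (1/3) * Ising (1/3)) := by
          have hm' : Measurable fun q : ℝ × ℝ =>
              {u : ℝ | u ^ 2 < 1}.indicator (singPow (1/3)) q.1 * {u : ℝ | u ^ 2 < 1}.indicator (singPow (1/3)) q.2 :=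
            ((measurable_boxSing _).comp measurable_fst).mul ((measurable_boxSing _).comp measurable_snd)
          rw [lintegral_const_mul _ hm', lintegral_volume_prod_mul (measurable_boxSing _) (measurable_boxSing _)]
          rfl
  rw [lintegral_volume_prod _ (measurable_Fdom r)]
  have hout : ∀ p₀ : ℝ × ℝ, ∫⁻ u, Fdom r (p₀, u) = sqBox.indicator (fun _ => (1 : ℝ≥0∞)) p₀ *
      ∫⁻ u : (ℝ × ℝ) × ((ℝ × ℝ) × (ℝ × ℝ)), sqBox.indicator (fun _ => (1 : ℝ≥0∞)) u.1 * (gq r u.1 u.2.1 * gq r u.1 u.2.2) := by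
    intro p₀
    show ∫⁻ u : (ℝ × ℝ) × ((ℝ × ℝ) × (ℝ × ℝ)), sqBox.indicator (fun _ => (1 : ℝ≥0∞)) p₀ *
        (sqBox.indicator (fun _ => (1 : ℝ≥0∞)) u.1 * (gq r u.1 u.2.1 * gq r u.1 u.2.2)) = _
    rw [lintegral_const_mul _ (measurable_Fdom_inner r)]
  simp_rw [hout]
  rw [lintegral_mul_const _ (measurable_const.indicator measurableSet_sqBox), lintegral_indicator measurableSet_sqBox,
    setLIntegral_const, one_mul, volume_sqBox]
  exact mul_le_mul' le_rfl hmid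

/-- The dominator is majorised by `Fdom` in the pair frame (in fact equal, up to disc ⊆ square). [folklore] -/
theorem dominator_le_Fdom (r : ℝ) (z : ℍ × ℍ) : dominator r z.1 z.2 ≤ Fdom r (pairCoord z) := by
  rw [dominator_def]
  by_cases hx : z.1.re ^ 2 + z.1.imI ^ 2 < 1
  swap
  · rw [indicator_of_notMem (show z.1 ∉ {x : ℍ | x.re ^ 2 + x.imI ^ 2 < 1} from hx), zero_mul, zero_mul]; exact bot_le
  by_cases hy : z.2.re ^ 2 + z.2.imI ^ 2 < 1
  swap
  · rw [indicator_of_notMem (show z.2 ∉ {y : ℍ | y.re ^ 2 + y.imI ^ 2 < 1} from hy), mul_zero, zero_mul]; exact bot_le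
  have h0 : (z.1.re, z.2.re) ∈ sqBox :=
    ⟨by show z.1.re ^ 2 < 1; nlinarith [sq_nonneg z.1.imI], by show z.2.re ^ 2 < 1; nlinarith [sq_nonneg z.2.imI]⟩
  have hI : (z.1.imI, z.2.imI) ∈ sqBox :=
    ⟨by show z.1.imI ^ 2 < 1; nlinarith [sq_nonneg z.1.re], by show z.2.imI ^ 2 < 1; nlinarith [sq_nonneg z.2.re]⟩
  refine le_of_eq ?_
  rw [indicator_of_mem (show z.1 ∈ {x : ℍ | x.re ^ 2 + x.imI ^ 2 < 1} from hx),
    indicator_of_mem (show z.2 ∈ {y : ℍ | y.re ^ 2 + y.imI ^ 2 < 1} from hy), one_mul, one_mul]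
  unfold Fdom
  rw [show (pairCoord z).1 = (z.1.re, z.2.re) from rfl, show (pairCoord z).2.1 = (z.1.imI, z.2.imI) from rfl,
    show (pairCoord z).2.2.1 = (z.1.imJ, z.2.imJ) from rfl, show (pairCoord z).2.2.2 = (z.1.imK, z.2.imK) from rfl,
    indicator_of_mem h0, indicator_of_mem hI, one_mul, one_mul]
  rw [gq_def, gq_def, ← ENNReal.ofReal_mul (Real.exp_pos _).le, ← Real.exp_add]
  congr 2
  ring

/-- The uncurried dominator is measurable. [folklore] -/
theorem measurable_dominator_uncurry (r : ℝ) : Measurable fun z : ℍ × ℍ => dominator r z.1 z.2 := by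
  have hS : MeasurableSet {x : ℍ | x.re ^ 2 + x.imI ^ 2 < 1} := measurableSet_lt (by fun_prop) measurable_const
  have hE : Measurable fun z : ℍ × ℍ => -(4 * (r ^ 2 * (z.1.imJ ^ 2 + z.1.imK ^ 2 + z.2.imJ ^ 2 + z.2.imK ^ 2) +
      ((z.1.imK * z.2.imI - z.1.imI * z.2.imK) ^ 2 + (z.1.imI * z.2.imJ - z.1.imJ * z.2.imI) ^ 2))) := by fun_prop
  have e : (fun z : ℍ × ℍ => dominator r z.1 z.2) = fun z => ({x : ℍ | x.re ^ 2 + x.imI ^ 2 < 1}.indicator (fun _ => (1 : ℝ≥0∞)) z.1) *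
      ({y : ℍ | y.re ^ 2 + y.imI ^ 2 < 1}.indicator (fun _ => (1 : ℝ≥0∞)) z.2) *
      ENNReal.ofReal (Real.exp (-(4 * (r ^ 2 * (z.1.imJ ^ 2 + z.1.imK ^ 2 + z.2.imJ ^ 2 + z.2.imK ^ 2) +
        ((z.1.imK * z.2.imI - z.1.imI * z.2.imK) ^ 2 + (z.1.imI * z.2.imJ - z.1.imJ * z.2.imI) ^ 2))))) := by
    funext z; rw [dominator_def]
  rw [e]
  exact (((measurable_const.indicator hS).comp measurable_fst).mul ((measurable_const.indicator hS).comp measurable_snd)).mul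
    (ENNReal.measurable_ofReal.comp (Real.measurable_exp.comp hE))

/-- ★★ **THE DOMINATOR IS INTEGRABLE, QUANTITATIVELY**: `∫∫ G_r ≤ 4·(π²/48)(r²)^{−4/3}·I(1/3)²` (`r > 0`). [folklore] -/
theorem lintegral_dominator_le {r : ℝ} (hr : 0 < r) :
    ∫⁻ z, dominator r z.1 z.2 ∂((volume : Measure ℍ).prod volume) ≤
      4 * (ENNReal.ofReal (Real.pi ^ 2 / 48 * (r ^ 2) ^ (-(4/3 : ℝ))) * (Ising (1/3) * Ising (1/3))) := by
  calc ∫⁻ z, dominator r z.1 z.2 ∂((volume : Measure ℍ).prod volume)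
      ≤ ∫⁻ z, Fdom r (pairCoord z) ∂((volume : Measure ℍ).prod volume) := lintegral_mono (dominator_le_Fdom r)
    _ = ∫⁻ w, Fdom r w := measurePreserving_pairCoord.lintegral_comp (measurable_Fdom r)
    _ ≤ _ := lintegral_Fdom_le hr

end Summit.QuantumFields.YangMills.Theorems.SwapVirialDeficit.ZeroModeGroup

end
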